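import Summits.ResolutionOfSingularities.ResolutionOfSingularities.Theses.RadicialJung
import Summits.ResolutionOfSingularities.ResolutionOfSingularities.Theorems.RadicialJungCleanModelsStubCompletionDerivationUnit
import Summits.ResolutionOfSingularities.ResolutionOfSingularities.Theorems.RadicialJungCleanModelsStubCompletionLift
import Summits.ResolutionOfSingularities.ResolutionOfSingularities.Theorems.RadicialJungCleanModelsStubLeibnizObstruction
import Summits.ResolutionOfSingularities.ResolutionOfSingularities.Theorems.RadicialJungCleanModelsStubParameterSubset
import Summits.ResolutionOfSingularities.ResolutionOfSingularities.Theorems.RadicialJungCleanModelsStubExtendParameter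
import Summits.ResolutionOfSingularities.ResolutionOfSingularities.Theorems.RadicialJungCleanModelsStubToroidalTwist
import Summits.ResolutionOfSingularities.ResolutionOfSingularities.Theorems.RadicialJungCleanModelsStubParameterGenerises
import HarnessLib

/-!
# Route `RadicialJung`, crux `CleanModels`: loose cleanness generises

Route `ResolutionOfSingularities/RadicialJung`, crux item `CleanModels`
(stmt-ResolutionOfSingularities-15917), line `Sketch`, lead prover, 2026-08-17.

`CleanModels` = LOG-CLEAN MODELS EXIST (a proper birational regular model of `W` on which a
degree-`p` purely inseparable `L/K(W)` is pointwise log-clean). The algebraic heart of "closed points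
suffice" (`RadicialJungCleanModelsClosedPoints.lean`): **GENERISATION of loose cleanness** from a
regular local ring `O = 𝒪_{V,v}` of characteristic `p` (fraction field `K`) to its localisation `O_q`
at a prime `q` (`stub_looseGenerises`, the registered assembly stub of the line, proved here from
the landed stubs):

* regular type (i) (a unit `u`, residually not a `p`-th power): a derivation `D` of the completion
  `Ô` with `D(u)` a unit (`stub_completionDerivationUnit`: Cohen structure theorem + weak `p`-basis
  theorem) does not vanish at a prime `Q` of `Ô` over `q` (`stub_completionLift`: faithful
  flatness), so by the Leibniz obstruction (`stub_leibnizObstruction`, Stacks 07PF) `u` is of loose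
  regular type at `O_q` (`regularType_generises`);
* regular type (ii) (`t₀ = s - c^p ∈ 𝔪 ∖ 𝔪²`): complete `t₀` to a regular system of parameters
  (`stub_extendParameter`); if `t₀ ∈ q` it is a boundary parameter of a loosely toroidal form at `q`
  (`stub_parameterGenerises`), otherwise `∂/∂t₀` on `Ô` (`stub_completionDerivationParam`) has
  `D(t₀) = 1 ∉ Q`;
* toroidal type `u ∏ t_i^{a_i}`: if some boundary parameter lies in `q`, the form stays loosely
  toroidal at `q` (`stub_parameterGenerises`, Serre's localisation theorem); if none does, the twisted
  representative `e^p x^α = u^α t_0 ∏_{i>0} t_i^{r_i}` (`α a_0 ≡ 1 mod p`) has `∂/∂t_0`-derivative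
  outside every prime over `q` (`stub_toroidalTwist`), hence is of loose regular type at `q`.
-/

noncomputable section

set_option linter.dupNamespace false -- mandated namespace of this single-conjunct summit

open CategoryTheory AlgebraicGeometry TopologicalSpace IsLocalRing
open Literature.AlgebraicGeometry.Resolution Literature.AlgebraicGeometry.Motives

namespace Summit.ResolutionOfSingularities.ResolutionOfSingularities.Theorems.RadicialJung.CleanModels

universe u

/-! ## Generisation of loose cleanness -/

/-- **Regular type generises** (the common end of the argument). Let `O` be a regular local ring
of prime characteristic `p`, `q` a prime, `O'` the localisation at `q`, and `f ∈ O ∖ q` such that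
some derivation `D` of the completion `Ô` has `D(f) ∉ Q` for every prime `Q` of `Ô` over `q`. Then
`f` is of loose regular type at `O'`: either `f - c^p ∉ 𝔪_{O'}` for all `c`, or
`f - c^p ∈ 𝔪_{O'} ∖ 𝔪_{O'}²` for some `c` (a prime `Q` over `q` exists by `stub_completionLift`,
and `stub_leibnizObstruction` applies). -/
theorem regularType_generises {O : Type u} [CommRing O] [IsRegularLocalRing O] (p : ℕ)
    [Fact p.Prime] [CharP O p] (q : Ideal O) [q.IsPrime] (O' : Type*) [CommRing O']
    [IsLocalRing O'] [Algebra O O'] [IsLocalization.AtPrime O' q] (f : O) (hfq : f ∉ q)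
    (hD : ∃ D : Derivation ℤ (AdicCompletion (maximalIdeal O) O) (AdicCompletion (maximalIdeal O) O),
      ∀ Q : Ideal (AdicCompletion (maximalIdeal O) O), Q.IsPrime →
        Q.comap (algebraMap O (AdicCompletion (maximalIdeal O) O)) = q →
        D (algebraMap O (AdicCompletion (maximalIdeal O) O) f) ∉ Q) :
    (IsUnit (algebraMap O O' f) ∧ ∀ c : O', algebraMap O O' f - c ^ p ∉ maximalIdeal O') ∨
      (∃ c : O', algebraMap O O' f - c ^ p ∈ maximalIdeal O' ∧
        algebraMap O O' f - c ^ p ∉ maximalIdeal O' ^ 2) := by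
  obtain ⟨hinj, -, hlift⟩ := stub_completionLift (O := O)
  haveI : CharP (AdicCompletion (maximalIdeal O) O) p := charP_of_injective_algebraMap hinj p
  obtain ⟨D, hD⟩ := hD
  obtain ⟨Q, hQ, hQq⟩ := hlift q inferInstance
  have hunit : IsUnit (algebraMap O O' f) :=
    IsLocalization.map_units O' (⟨f, hfq⟩ : q.primeCompl)
  by_cases h : ∃ c : O', algebraMap O O' f - c ^ p ∈ maximalIdeal O'
  · obtain ⟨c, hc⟩ := h
    exact Or.inr ⟨c, hc, stub_leibnizObstruction (algebraMap O (AdicCompletion (maximalIdeal O) O))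
      p Fact.out q Q hQq D f (hD Q hQ hQq) c hc⟩
  · push Not at h
    exact Or.inl ⟨hunit, h⟩

/-- **Loose cleanness generises** (lead assembly). Let `O` be a regular local ring of prime
characteristic `p` with fraction field `K`, `q` a prime and `O'` the localisation of `O` at `q`
(inside `K`). If `x ∈ K` is loosely clean with respect to `O` (toroidal with a unit factor,
residually new unit, or `c^p +` regular parameter), then some admissible modification
`e^p x^α - c^p` (`p ∤ α`, `e ≠ 0`) is loosely clean with respect to `O'`. (Types (i)/(ii) and the
toroidal case with no boundary parameter in `q`: a derivation of `Ô` adapted to the situation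
(`stub_completionDerivationUnit` / `stub_completionDerivationParam`) does not vanish at a prime of
`Ô` over `q` (`stub_completionLift`) on the modified representative, so `stub_leibnizObstruction`
gives type (i) or (ii) at `q`; the toroidal case with boundary parameters in `q`:
`stub_parameterSubset`.) -/
theorem stub_looseGenerises {O : Type u} [CommRing O] [IsRegularLocalRing O] (p : ℕ)
    [Fact p.Prime] [CharP O p] {K : Type u} [Field K] [Algebra O K] [IsFractionRing O K]
    (q : Ideal O) [q.IsPrime] (O' : Type u) [CommRing O'] [IsLocalRing O'] [Algebra O O']
    [IsLocalization.AtPrime O' q] [Algebra O' K] [IsScalarTower O O' K] (x : K)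
    (hx : (∃ (d m : ℕ) (hmd : m ≤ d) (t : Fin d → O) (a : Fin m → ℕ) (u : O), IsUnit u ∧
          Ideal.span (Set.range t) = maximalIdeal O ∧
          ringKrullDim O = (d : WithBot ℕ∞) ∧ 0 < m ∧ (∀ i, ¬ p ∣ a i) ∧
          x = algebraMap O K (u * ∏ i : Fin m, t (Fin.castLE hmd i) ^ (a i))) ∨
        (∃ u : O, IsUnit u ∧ x = algebraMap O K u ∧ ∀ c : O, u - c ^ p ∉ maximalIdeal O) ∨
        (∃ s c : O, x = algebraMap O K s ∧ s - c ^ p ∈ maximalIdeal O ∧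
          s - c ^ p ∉ maximalIdeal O ^ 2)) :
    ∃ (α : ℕ) (e c : K), α.Coprime p ∧ e ≠ 0 ∧
      ((∃ (d m : ℕ) (hmd : m ≤ d) (t : Fin d → O') (a : Fin m → ℕ) (u : O'), IsUnit u ∧
          Ideal.span (Set.range t) = maximalIdeal O' ∧
          ringKrullDim O' = (d : WithBot ℕ∞) ∧ 0 < m ∧ (∀ i, ¬ p ∣ a i) ∧
          e ^ p * x ^ α - c ^ p =
            algebraMap O' K (u * ∏ i : Fin m, t (Fin.castLE hmd i) ^ (a i))) ∨
        (∃ u : O', IsUnit u ∧ e ^ p * x ^ α - c ^ p = algebraMap O' K u ∧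
          ∀ c' : O', u - c' ^ p ∉ maximalIdeal O') ∨
        (∃ s c' : O', e ^ p * x ^ α - c ^ p = algebraMap O' K s ∧
          s - c' ^ p ∈ maximalIdeal O' ∧ s - c' ^ p ∉ maximalIdeal O' ^ 2)) := by
  have hp : p.Prime := Fact.out
  rcases hx with ⟨d, m, hmd, t, a, u, hu, ht, hd, hm, ha, rfl⟩ | ⟨u, hu, rfl, hwound⟩ |
    ⟨s, c₀, rfl, hc₁, hc₂⟩
  · -- toroidal type
    by_cases hS : ∃ i : Fin m, t (Fin.castLE hmd i) ∈ q
    · obtain ⟨d', m', hmd', t', a', u', hu', ht', hd', hm', ha', heq⟩ :=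
        stub_parameterGenerises p (K := K) hmd t a u hu ht hd ha q hS O'
      refine ⟨1, 1, 0, Nat.coprime_one_left p, one_ne_zero,
        Or.inl ⟨d', m', hmd', t', a', u', hu', ht', hd', hm', ha', ?_⟩⟩
      rw [one_pow, one_mul, pow_one, zero_pow hp.ne_zero, sub_zero, heq]
    · push Not at hS
      obtain ⟨α, e, f, hα, he, hfq, hef, hD⟩ :=
        stub_toroidalTwist p (K := K) hmd t a u hu ht hd hm ha q hS
      have hx' : e ^ p * algebraMap O K (u * ∏ i : Fin m, t (Fin.castLE hmd i) ^ a i) ^ α -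
          (0 : K) ^ p = algebraMap O' K (algebraMap O O' f) := by
        rw [zero_pow hp.ne_zero, sub_zero, hef, IsScalarTower.algebraMap_apply O O' K]
      rcases regularType_generises p q O' f hfq hD with ⟨hunit, hno⟩ | ⟨c', hc'1, hc'2⟩
      · exact ⟨α, e, 0, hα, he, Or.inr (Or.inl ⟨algebraMap O O' f, hunit, hx', hno⟩)⟩
      · exact ⟨α, e, 0, hα, he, Or.inr (Or.inr ⟨algebraMap O O' f, c', hx', hc'1, hc'2⟩)⟩
  · -- residually new unit
    obtain ⟨D, hDu⟩ := stub_completionDerivationUnit p u hwound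
    have hfq : u ∉ q := fun h =>
      Ideal.IsPrime.ne_top ‹q.IsPrime› (Ideal.eq_top_of_isUnit_mem _ h hu)
    have hD : ∃ D : Derivation ℤ (AdicCompletion (maximalIdeal O) O) (AdicCompletion (maximalIdeal O) O),
        ∀ Q : Ideal (AdicCompletion (maximalIdeal O) O), Q.IsPrime →
          Q.comap (algebraMap O (AdicCompletion (maximalIdeal O) O)) = q →
          D (algebraMap O (AdicCompletion (maximalIdeal O) O) u) ∉ Q :=
      ⟨D, fun Q hQ _ hmem => hQ.ne_top (Ideal.eq_top_of_isUnit_mem _ hmem hDu)⟩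
    have hx' : (1 : K) ^ p * algebraMap O K u ^ 1 - (0 : K) ^ p =
        algebraMap O' K (algebraMap O O' u) := by
      rw [one_pow, one_mul, pow_one, zero_pow hp.ne_zero, sub_zero,
        IsScalarTower.algebraMap_apply O O' K]
    rcases regularType_generises p q O' u hfq hD with ⟨hunit, hno⟩ | ⟨c', hc'1, hc'2⟩
    · exact ⟨1, 1, 0, Nat.coprime_one_left p, one_ne_zero,
        Or.inr (Or.inl ⟨algebraMap O O' u, hunit, hx', hno⟩)⟩
    · exact ⟨1, 1, 0, Nat.coprime_one_left p, one_ne_zero,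
        Or.inr (Or.inr ⟨algebraMap O O' u, c', hx', hc'1, hc'2⟩)⟩
  · -- `c₀^p +` regular parameter `t₀`
    set t₀ : O := s - c₀ ^ p with ht₀def
    obtain ⟨d, hd0, t, ht, hd, ht0⟩ := stub_extendParameter t₀ hc₁ hc₂
    have hx' : (1 : K) ^ p * algebraMap O K s ^ 1 - algebraMap O K c₀ ^ p =
        algebraMap O' K (algebraMap O O' t₀) := by
      rw [one_pow, one_mul, pow_one, ← map_pow, ← map_sub, IsScalarTower.algebraMap_apply O O' K]
    by_cases hq0 : t₀ ∈ q
    · -- `t₀ ∈ q`: toroidal at `q` with the single boundary parameter `t₀`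
      have hd1 : 1 ≤ d := hd0
      have hcast : t (Fin.castLE hd1 0) = t₀ := by
        rw [← ht0]; congr 1
      obtain ⟨d', m', hmd', t', a', u', hu', ht', hd', hm', ha', heq⟩ :=
        stub_parameterGenerises p (K := K) (m := 1) hd1 t (fun _ => 1) 1 isUnit_one ht hd
          (fun _ h1 => hp.one_lt.ne' (Nat.dvd_one.mp h1)) q ⟨0, by rw [hcast]; exact hq0⟩ O'
      refine ⟨1, 1, algebraMap O K c₀, Nat.coprime_one_left p, one_ne_zero,
        Or.inl ⟨d', m', hmd', t', a', u', hu', ht', hd', hm', ha', ?_⟩⟩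
      rw [hx', ← heq, one_mul, Fin.prod_univ_one, pow_one, hcast,
        ← IsScalarTower.algebraMap_apply O O' K]
    · -- `t₀ ∉ q`: the derivation `∂/∂t₀` of `Ô`
      obtain ⟨D, hD1, -⟩ := stub_completionDerivationParam p t ht hd ⟨0, hd0⟩
      have hD : ∃ D : Derivation ℤ (AdicCompletion (maximalIdeal O) O) (AdicCompletion (maximalIdeal O) O),
          ∀ Q : Ideal (AdicCompletion (maximalIdeal O) O), Q.IsPrime →
            Q.comap (algebraMap O (AdicCompletion (maximalIdeal O) O)) = q →
            D (algebraMap O (AdicCompletion (maximalIdeal O) O) t₀) ∉ Q := by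
        refine ⟨D, fun Q hQ _ hmem => hQ.ne_top ((Ideal.eq_top_iff_one Q).mpr ?_)⟩
        rwa [← ht0, hD1] at hmem
      rcases regularType_generises p q O' t₀ hq0 hD with ⟨hunit, hno⟩ | ⟨c', hc'1, hc'2⟩
      · exact ⟨1, 1, algebraMap O K c₀, Nat.coprime_one_left p, one_ne_zero,
          Or.inr (Or.inl ⟨algebraMap O O' t₀, hunit, hx', hno⟩)⟩
      · exact ⟨1, 1, algebraMap O K c₀, Nat.coprime_one_left p, one_ne_zero,
          Or.inr (Or.inr ⟨algebraMap O O' t₀, c', hx', hc'1, hc'2⟩)⟩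

end Summit.ResolutionOfSingularities.ResolutionOfSingularities.Theorems.RadicialJung.CleanModels

end
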